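import Literature.Analysis.FluidPDE.ElgindiEllipticWeakExistence
import Mathlib.MeasureTheory.Measure.Lebesgue.Basic
import HarnessLib

/-!
# Radial dilations on `L²(strip)` and the dilation symmetry of the weak problem
([Elgindi2021] §7, "`L^k_{α,T}` commutes with `D_R`")

Topic `Literature/Analysis/FluidPDE`. Support file (definitions with bodies and proved theorems, no
named facts) on the proof path of the named fact
`Literature.Analysis.FluidPDE.Elgindi.ElgindiGhoulMasmoudi2021_stabilityCore`
(`ElgindiStabilityDecomposition.lean`). T. M. Elgindi, Ann. of Math. 194 (2021) =
arXiv:1904.04795, §7: the radial part of `L_α` is an Euler operator in `R`, so the problem commutes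
with the dilations `R ↦ aR` (equivalently with `D_R = R∂_R`, "`L^k_{α,T}` commutes with `D_R`",
proof of Theorem 3 of [EGM], p. 13 of arXiv:1910.14071). This symmetry is the source of the radial
regularity of weak solutions.

* `dil a (R,θ) = (aR, θ)`; `Measure.map (dil a) (vol|strip) = a⁻¹ • vol|strip` (`map_dil_stripMeasure`);
  `∫∫_strip G(aR,θ) = a⁻¹∫∫_strip G` (`integral_strip_dil`).
* `dilL2 a : L²(strip) →L L²(strip)`, `f ↦ f(a·, ·)` (`dilL2`, `dilL2_ae_eq`), with the adjoint
  relation `⟨dilL2 a f, g⟩ = a⁻¹⟨f, dilL2 a⁻¹ g⟩` (`inner_dilL2`); `dilE a` acts componentwise on `E⁴`.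
* `dilE a` maps graphs to graphs of dilated test functions and the energy space to itself
  (`dilE_graphElt`, `dilE_mem_weakSpace`), and `B(dilE a U, Φ) = a⁻¹B(U, dilE a⁻¹ Φ)`
  (`energyForm_dilE`); consequently the weak solution map commutes with dilations
  (`weakSolution_dilE`).
-/

noncomputable section

open MeasureTheory Set Real Filter Function
open _root_.Topology
open scoped ENNReal InnerProductSpace

namespace Literature.Analysis.FluidPDE

namespace Elgindi

/-! ### The dilation map and the strip measure -/

/-- The radial dilation `(R, θ) ↦ (aR, θ)`. [folklore] -/
def dil (a : ℝ) : ℝ × ℝ → ℝ × ℝ := fun p => (a * p.1, p.2)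

/-- Unfolding `dil`. [folklore] -/
theorem dil_apply (a : ℝ) (p : ℝ × ℝ) : dil a p = (a * p.1, p.2) := rfl

/-- `dil a ∘ dil b = dil (a·b)`. [folklore] -/
theorem dil_dil (a b : ℝ) (p : ℝ × ℝ) : dil a (dil b p) = dil (a * b) p := by
  simp only [dil_apply]
  rw [mul_assoc]

/-- `dil 1 = id`. [folklore] -/
theorem dil_one (p : ℝ × ℝ) : dil 1 p = p := by simp [dil_apply]

/-- `dil a` is continuous. [folklore] -/
theorem continuous_dil (a : ℝ) : Continuous (dil a) := by unfold dil; fun_prop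

/-- `dil a` is measurable. [folklore] -/
theorem measurable_dil (a : ℝ) : Measurable (dil a) := (continuous_dil a).measurable

/-- `dil a` as a homeomorphism (`a ≠ 0`). [folklore] -/
def dilHomeo {a : ℝ} (ha : a ≠ 0) : ℝ × ℝ ≃ₜ ℝ × ℝ where
  toFun := dil a
  invFun := dil a⁻¹
  left_inv p := by rw [dil_dil, inv_mul_cancel₀ ha, dil_one]
  right_inv p := by rw [dil_dil, mul_inv_cancel₀ ha, dil_one]
  continuous_toFun := continuous_dil a
  continuous_invFun := continuous_dil a⁻¹

/-- `dil a` is a measurable embedding (`a ≠ 0`). [folklore] -/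
theorem measurableEmbedding_dil {a : ℝ} (ha : a ≠ 0) : MeasurableEmbedding (dil a) :=
  (dilHomeo ha).measurableEmbedding

/-- The strip is dilation invariant (`a > 0`). [folklore] -/
theorem dil_preimage_strip {a : ℝ} (ha : 0 < a) : dil a ⁻¹' strip = strip := by
  ext p
  simp only [mem_preimage, dil_apply, strip, mem_prod, mem_Ioi]
  constructor
  · rintro ⟨h1, h2⟩; exact ⟨(mul_pos_iff_of_pos_left ha).mp h1, h2⟩
  · rintro ⟨h1, h2⟩; exact ⟨mul_pos ha h1, h2⟩

/-- `dil a` maps the strip to itself (`a > 0`). [folklore] -/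
theorem dil_mem_strip {a : ℝ} (ha : 0 < a) {p : ℝ × ℝ} (hp : p ∈ strip) : dil a p ∈ strip := by
  rw [← dil_preimage_strip ha] at hp; exact hp

/-- **`Measure.map (dil a) vol = a⁻¹ • vol`** on `ℝ²` (`a > 0`). [folklore] -/
theorem map_dil_volume {a : ℝ} (ha : 0 < a) :
    Measure.map (dil a) (volume : Measure (ℝ × ℝ)) = ENNReal.ofReal a⁻¹ • volume := by
  have e : dil a = Prod.map (fun x : ℝ => a * x) id := by funext p; rfl
  rw [e, Measure.volume_eq_prod, ← Measure.map_prod_map _ _ (measurable_const_mul a) measurable_id, Measure.map_id,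
    Real.map_volume_mul_left ha.ne', abs_of_pos (inv_pos.2 ha), Measure.prod_smul_left]

/-- **`Measure.map (dil a) (vol|strip) = a⁻¹ • vol|strip`** (`a > 0`). [folklore] -/
theorem map_dil_stripMeasure {a : ℝ} (ha : 0 < a) :
    Measure.map (dil a) stripMeasure = ENNReal.ofReal a⁻¹ • stripMeasure := by
  rw [stripMeasure_def]
  have h := Measure.restrict_map (μ := (volume : Measure (ℝ × ℝ))) (measurable_dil a) measurableSet_strip
  rw [dil_preimage_strip ha, map_dil_volume ha, Measure.restrict_smul] at h
  exact h.symm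

/-- `dil a` is quasi-measure-preserving on the strip (`a > 0`). [folklore] -/
theorem quasiMeasurePreserving_dil {a : ℝ} (ha : 0 < a) : Measure.QuasiMeasurePreserving (dil a) stripMeasure stripMeasure := by
  refine ⟨measurable_dil a, ?_⟩
  rw [map_dil_stripMeasure ha]
  exact Measure.absolutelyContinuous_of_le_smul le_rfl

/-- **Change of variables on the strip**: `∫∫_strip G(aR,θ) = a⁻¹∫∫_strip G` (`a > 0`). [folklore] -/
theorem integral_strip_dil {a : ℝ} (ha : 0 < a) (G : ℝ × ℝ → ℝ) :
    ∫ p in strip, G (dil a p) = a⁻¹ * ∫ p in strip, G p := by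
  have h := (measurableEmbedding_dil ha.ne').integral_map (μ := stripMeasure) G
  rw [map_dil_stripMeasure ha, integral_smul_measure, ENNReal.toReal_ofReal (inv_pos.2 ha).le, smul_eq_mul] at h
  rw [← stripMeasure_def]
  exact h.symm

/-! ### The dilation operator on `L²(strip)` -/

/-- `f ∘ dil a ∈ L²(strip)` for `f ∈ L²(strip)` (`a > 0`). [folklore] -/
theorem memLp_comp_dil {a : ℝ} (ha : 0 < a) {f : ℝ × ℝ → ℝ} (hf : MemLp f 2 stripMeasure) : MemLp (f ∘ dil a) 2 stripMeasure := by
  refine MemLp.comp_of_map ?_ (measurable_dil a).aemeasurable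
  rw [map_dil_stripMeasure ha]
  exact hf.smul_measure ENNReal.ofReal_ne_top

/-- The dilation as a linear map on `L²(strip)` (`a > 0`). [folklore] -/
def dilLin {a : ℝ} (ha : 0 < a) : L2Strip →ₗ[ℝ] L2Strip where
  toFun f := (memLp_comp_dil ha (Lp.memLp f)).toLp _
  map_add' f g := by
    refine (MemLp.toLp_eq_toLp_iff _ _).2 ?_ |>.trans (MemLp.toLp_add _ _)
    exact (quasiMeasurePreserving_dil ha).ae_eq (Lp.coeFn_add f g)
  map_smul' c f := by
    refine (MemLp.toLp_eq_toLp_iff _ _).2 ?_ |>.trans (MemLp.toLp_const_smul _ _)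
    exact (quasiMeasurePreserving_dil ha).ae_eq (Lp.coeFn_smul c f)

/-- The a.e. representative of `dilLin`. [folklore] -/
theorem dilLin_ae_eq {a : ℝ} (ha : 0 < a) (f : L2Strip) :
    (dilLin ha f : ℝ × ℝ → ℝ) =ᵐ[stripMeasure] fun p => (f : ℝ × ℝ → ℝ) (dil a p) := (memLp_comp_dil ha (Lp.memLp f)).coeFn_toLp

/-- The a.e. representative of `dilLin`, with the measure displayed as `vol|strip`. [folklore] -/
theorem dilLin_ae_eq' {a : ℝ} (ha : 0 < a) (f : L2Strip) :
    (dilLin ha f : ℝ × ℝ → ℝ) =ᵐ[volume.restrict strip] fun p => (f : ℝ × ℝ → ℝ) (dil a p) := dilLin_ae_eq ha f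

/-- **The adjoint relation** `⟨f ∘ dil a, g⟩ = a⁻¹⟨f, g ∘ dil a⁻¹⟩`. [folklore] -/
theorem inner_dilLin {a : ℝ} (ha : 0 < a) (f g : L2Strip) :
    ⟪dilLin ha f, g⟫_ℝ = a⁻¹ * ⟪f, dilLin (inv_pos.2 ha) g⟫_ℝ := by
  rw [inner_L2Strip, inner_L2Strip]
  have e1 : ∫ p in strip, (dilLin ha f : ℝ × ℝ → ℝ) p * (g : ℝ × ℝ → ℝ) p =
      ∫ p in strip, (f : ℝ × ℝ → ℝ) (dil a p) * (g : ℝ × ℝ → ℝ) p := by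
    refine integral_congr_ae ?_
    filter_upwards [dilLin_ae_eq' ha f] with p hp
    rw [hp]
  have e2 : ∫ p in strip, (f : ℝ × ℝ → ℝ) p * (dilLin (inv_pos.2 ha) g : ℝ × ℝ → ℝ) p =
      ∫ p in strip, (f : ℝ × ℝ → ℝ) p * (g : ℝ × ℝ → ℝ) (dil a⁻¹ p) := by
    refine integral_congr_ae ?_
    filter_upwards [dilLin_ae_eq' (inv_pos.2 ha) g] with p hp
    rw [hp]
  rw [e1, e2]
  have e3 : (fun p : ℝ × ℝ => (f : ℝ × ℝ → ℝ) (dil a p) * (g : ℝ × ℝ → ℝ) p) =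
      fun p => (fun q : ℝ × ℝ => (f : ℝ × ℝ → ℝ) q * (g : ℝ × ℝ → ℝ) (dil a⁻¹ q)) (dil a p) := by
    funext p
    simp only [dil_dil, inv_mul_cancel₀ ha.ne', dil_one]
  rw [e3]
  exact integral_strip_dil ha (fun q : ℝ × ℝ => (f : ℝ × ℝ → ℝ) q * (g : ℝ × ℝ → ℝ) (dil a⁻¹ q))

/-- `‖f ∘ dil a‖² = a⁻¹‖f‖²`. [folklore] -/
theorem norm_dilLin_sq {a : ℝ} (ha : 0 < a) (f : L2Strip) : ‖dilLin ha f‖ ^ 2 = a⁻¹ * ‖f‖ ^ 2 := by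
  rw [← real_inner_self_eq_norm_sq, inner_dilLin ha, ← real_inner_self_eq_norm_sq]
  congr 1
  -- `dilLin a⁻¹ (dilLin a f) = f`
  have h : dilLin (inv_pos.2 ha) (dilLin ha f) = f := by
    apply Lp.ext
    have h1 := dilLin_ae_eq (inv_pos.2 ha) (dilLin ha f)
    have h2 := (quasiMeasurePreserving_dil (inv_pos.2 ha)).ae_eq (dilLin_ae_eq ha f)
    refine h1.trans (h2.trans (ae_of_all _ fun p => ?_))
    show (f : ℝ × ℝ → ℝ) (dil a (dil a⁻¹ p)) = f p
    rw [dil_dil, mul_inv_cancel₀ ha.ne', dil_one]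
  rw [h]

/-- `‖f ∘ dil a‖ = a^{-1/2}‖f‖`. [folklore] -/
theorem norm_dilLin {a : ℝ} (ha : 0 < a) (f : L2Strip) : ‖dilLin ha f‖ = Real.sqrt a⁻¹ * ‖f‖ := by
  have h := norm_dilLin_sq ha f
  have h1 : ‖dilLin ha f‖ = Real.sqrt (‖dilLin ha f‖ ^ 2) := (Real.sqrt_sq (norm_nonneg _)).symm
  rw [h1, h, Real.sqrt_mul (inv_pos.2 ha).le, Real.sqrt_sq (norm_nonneg _)]

/-- **The dilation operator** `dilL2 a : L²(strip) →L L²(strip)`, `f ↦ f(a·,·)` (`a > 0`). [folklore] -/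
def dilL2 {a : ℝ} (ha : 0 < a) : L2Strip →L[ℝ] L2Strip :=
  (dilLin ha).mkContinuous (Real.sqrt a⁻¹) fun f => (norm_dilLin ha f).le

/-- `dilL2` and `dilLin` agree. [folklore] -/
theorem dilL2_apply {a : ℝ} (ha : 0 < a) (f : L2Strip) : dilL2 ha f = dilLin ha f := rfl

/-- The a.e. representative of `dilL2 a f`. [folklore] -/
theorem dilL2_ae_eq {a : ℝ} (ha : 0 < a) (f : L2Strip) :
    (dilL2 ha f : ℝ × ℝ → ℝ) =ᵐ[volume.restrict strip] fun p => (f : ℝ × ℝ → ℝ) (dil a p) := dilLin_ae_eq ha f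

/-- **Adjoint relation** `⟨dilL2 a f, g⟩ = a⁻¹⟨f, dilL2 a⁻¹ g⟩`. [folklore] -/
theorem inner_dilL2 {a : ℝ} (ha : 0 < a) (f g : L2Strip) : ⟪dilL2 ha f, g⟫_ℝ = a⁻¹ * ⟪f, dilL2 (inv_pos.2 ha) g⟫_ℝ :=
  inner_dilLin ha f g

/-- `dilL2 a⁻¹ ∘ dilL2 a = id`. [folklore] -/
theorem dilL2_inv_dilL2 {a : ℝ} (ha : 0 < a) (f : L2Strip) : dilL2 (inv_pos.2 ha) (dilL2 ha f) = f := by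
  apply Lp.ext
  have h1 := dilLin_ae_eq (inv_pos.2 ha) (dilLin ha f)
  have h2 := (quasiMeasurePreserving_dil (inv_pos.2 ha)).ae_eq (dilLin_ae_eq ha f)
  refine h1.trans (h2.trans (ae_of_all _ fun p => ?_))
  show (f : ℝ × ℝ → ℝ) (dil a (dil a⁻¹ p)) = f p
  rw [dil_dil, mul_inv_cancel₀ ha.ne', dil_one]

/-- `dilL2` of a square-integrable function given by a formula. [folklore] -/
theorem dilL2_toL2 {a : ℝ} (ha : 0 < a) {g : ℝ × ℝ → ℝ} (hg : MemLp g 2 stripMeasure) :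
    dilL2 ha (toL2 g) = toL2 (g ∘ dil a) := by
  apply Lp.ext
  have h1 := dilLin_ae_eq ha (toL2 g)
  have h2 := (quasiMeasurePreserving_dil ha).ae_eq (toL2_ae_eq hg)
  have h3 := toL2_ae_eq (memLp_comp_dil ha hg)
  exact h1.trans (h2.trans h3.symm)

/-! ### Dilations on `E⁴` and the energy form -/

/-- Componentwise dilation, as a linear map on `E⁴`. [folklore] -/
def dilELin {a : ℝ} (ha : 0 < a) : E4 →ₗ[ℝ] E4 where
  toFun U := WithLp.toLp 2 fun k => dilL2 ha (U k)
  map_add' U V := by ext k : 1; simp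
  map_smul' c U := by ext k : 1; simp

/-- `‖dilE U‖ = a^{-1/2}‖U‖`. [folklore] -/
theorem norm_dilELin {a : ℝ} (ha : 0 < a) (U : E4) : ‖dilELin ha U‖ = Real.sqrt a⁻¹ * ‖U‖ := by
  have h : ‖dilELin ha U‖ ^ 2 = (Real.sqrt a⁻¹ * ‖U‖) ^ 2 := by
    rw [mul_pow, Real.sq_sqrt (inv_pos.2 ha).le, PiLp.norm_sq_eq_of_L2, PiLp.norm_sq_eq_of_L2, Finset.mul_sum]
    refine Finset.sum_congr rfl fun k _ => ?_
    show ‖dilL2 ha (U k)‖ ^ 2 = a⁻¹ * ‖U k‖ ^ 2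
    rw [dilL2_apply, norm_dilLin_sq]
  have h0 : 0 ≤ Real.sqrt a⁻¹ * ‖U‖ := mul_nonneg (Real.sqrt_nonneg _) (norm_nonneg _)
  nlinarith [norm_nonneg (dilELin ha U), sq_nonneg (‖dilELin ha U‖ - Real.sqrt a⁻¹ * ‖U‖), sq_nonneg (‖dilELin ha U‖ + Real.sqrt a⁻¹ * ‖U‖)]

/-- **Componentwise dilation** `dilE a : E⁴ →L E⁴`. [folklore] -/
def dilE {a : ℝ} (ha : 0 < a) : E4 →L[ℝ] E4 := (dilELin ha).mkContinuous (Real.sqrt a⁻¹) fun U => (norm_dilELin ha U).le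

/-- Components of `dilE a U`. [folklore] -/
theorem dilE_apply {a : ℝ} (ha : 0 < a) (U : E4) (k : Fin 4) : dilE ha U k = dilL2 ha (U k) := rfl

/-- `dilE a⁻¹ ∘ dilE a = id`. [folklore] -/
theorem dilE_inv_dilE {a : ℝ} (ha : 0 < a) (U : E4) : dilE (inv_pos.2 ha) (dilE ha U) = U := by
  ext k : 1
  rw [dilE_apply, dilE_apply, dilL2_inv_dilL2]

/-- **`B(dilE a U, Φ) = a⁻¹B(U, dilE a⁻¹ Φ)`**: the energy form is dilation covariant. [cite: Elgindi2021, §7 ("L commutes with D_R"); EGM arXiv:1910.14071 proof of Theorem 3 (p. 13)] -/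
theorem energyForm_dilE {α a : ℝ} (ha : 0 < a) (U Φ : E4) :
    energyForm α (dilE ha U) Φ = a⁻¹ * energyForm α U (dilE (inv_pos.2 ha) Φ) := by
  simp only [energyForm_apply, dilE_apply, inner_dilL2 ha]
  ring

/-! ### Dilations preserve the energy space -/

/-- The dilated test function `χ_a(R,θ) = χ(aR,θ)`. [folklore] -/
def dilFn (a : ℝ) (χ : ℝ → ℝ → ℝ) : ℝ → ℝ → ℝ := fun R θ => χ (a * R) θ

/-- `uncurry (χ_a) = uncurry χ ∘ dil a`. [folklore] -/
theorem uncurry_dilFn (a : ℝ) (χ : ℝ → ℝ → ℝ) : uncurry (dilFn a χ) = uncurry χ ∘ dil a := by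
  funext p; rfl

/-- `∂_R(χ_a)(R,θ) = a(∂_Rχ)(aR,θ)`. [folklore] -/
theorem dz_dilFn (a : ℝ) {χ : ℝ → ℝ → ℝ} (hχ : ContDiff ℝ 1 (uncurry χ)) (R θ : ℝ) :
    dz (dilFn a χ) R θ = a * dz χ (a * R) θ := by
  show deriv (fun R' => χ (a * R') θ) R = a * deriv (fun R' => χ R' θ) (a * R)
  have hd : DifferentiableAt ℝ (fun R' => χ R' θ) (a * R) :=
    ((hχ.comp (contDiff_id.prodMk contDiff_const)).differentiable (by simp)) _
  have h1 : HasDerivAt (fun x : ℝ => a * x) a R := by simpa using (hasDerivAt_id R).const_mul a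
  have h := hd.hasDerivAt.comp R h1
  have e : ((fun R' => χ R' θ) ∘ fun x : ℝ => a * x) = fun R' => χ (a * R') θ := by funext x; rfl
  rw [e] at h
  rw [h.deriv]; ring

/-- `∂_θ(χ_a)(R,θ) = (∂_θχ)(aR,θ)`. [folklore] -/
theorem dθ_dilFn (a : ℝ) (χ : ℝ → ℝ → ℝ) (R θ : ℝ) : dθ (dilFn a χ) R θ = dθ χ (a * R) θ := rfl

/-- **Graphs dilate to graphs**: `graphFn α χ_a k = graphFn α χ k ∘ dil a`. [folklore] -/
theorem graphFn_dilFn {α a : ℝ} {χ : ℝ → ℝ → ℝ} (hχ : ContDiff ℝ 1 (uncurry χ)) (k : Fin 4) :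
    graphFn α (dilFn a χ) k = graphFn α χ k ∘ dil a := by
  funext p
  fin_cases k
  · rfl
  · show α * (p.1 * (Real.cos p.2 * dz (dilFn a χ) p.1 p.2)) = α * ((a * p.1) * (Real.cos p.2 * dz χ (a * p.1) p.2))
    rw [dz_dilFn a hχ]; ring
  · rfl
  · rfl

/-- The orthogonal test class is dilation invariant (`a > 0`). [folklore] -/
theorem dilFn_mem_orthClass {a : ℝ} (ha : 0 < a) {χ : ℝ → ℝ → ℝ} (hχ : χ ∈ orthClass) : dilFn a χ ∈ orthClass := by
  obtain ⟨hsm, hs, hpos, hχ0, hK⟩ := hχ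
  refine ⟨fun n => ?_, ?_, fun p hp => ?_, fun R => hχ0 (a * R), fun R hR => ?_⟩
  · rw [uncurry_dilFn]; exact (hsm n).comp ((contDiff_const.mul contDiff_fst).prodMk contDiff_snd)
  · rw [uncurry_dilFn]
    exact hs.comp_homeomorph (dilHomeo ha.ne')
  · rw [uncurry_dilFn] at hp
    have h : dil a p ∈ tsupport (uncurry χ) := by
      have := tsupport_comp_subset_preimage (uncurry χ) (continuous_dil a) hp
      exact this
    have := hpos _ h
    simp only [dil_apply] at this
    exact (mul_pos_iff_of_pos_left ha).mp this
  · have e : kMoment (fun R θ => Real.cos θ * dilFn a χ R θ) R = kMoment (fun R θ => Real.cos θ * χ R θ) (a * R) := by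
      rw [kMoment_def, kMoment_def]; rfl
    rw [e]; exact hK _ (mul_pos ha hR)

/-- **`dilE a (Jχ) = J(χ_a)`**. [folklore] -/
theorem dilE_graphElt {α a : ℝ} (ha : 0 < a) {χ : ℝ → ℝ → ℝ} (hχ : ContDiff ℝ 1 (uncurry χ)) (hs : HasCompactSupport (uncurry χ)) :
    dilE ha (graphElt α χ) = graphElt α (dilFn a χ) := by
  ext k : 1
  rw [dilE_apply, graphElt_apply, graphElt_apply, dilL2_toL2 ha (memLp_graphFn hχ hs k), graphFn_dilFn hχ]

/-- **Dilations preserve the energy space**. [folklore] -/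
theorem dilE_mem_weakSpace {α a : ℝ} (ha : 0 < a) {U : E4} (hU : U ∈ weakSpace α) : dilE ha U ∈ weakSpace α := by
  have hsub : dilE ha '' (LinearMap.range (graphL α) : Set E4) ⊆ (LinearMap.range (graphL α) : Set E4) := by
    rintro _ ⟨_, ⟨χ, rfl⟩, rfl⟩
    refine ⟨⟨dilFn a χ, dilFn_mem_orthClass ha χ.2⟩, ?_⟩
    rw [graphL_apply, graphL_apply]
    exact (dilE_graphElt ha (χ.2.1 1) χ.2.2.1).symm
  have hU' : U ∈ closure ((LinearMap.range (graphL α) : Set E4)) := by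
    rw [← Submodule.topologicalClosure_coe]; exact hU
  have h := image_closure_subset_closure_image (dilE ha).continuous ⟨U, hU', rfl⟩
  have h' := closure_mono hsub h
  show dilE ha U ∈ (weakSpace α : Set E4)
  rw [weakSpace, Submodule.topologicalClosure_coe]
  exact h'

/-- **The weak solution map commutes with dilations**: if `U` is a weak solution with datum `F`,
then `dilE a U` is a weak solution with datum `dilL2 a F`. [cite: Elgindi2021, §7 ("L commutes with D_R"); EGM arXiv:1910.14071 proof of Theorem 3 (p. 13)] -/
theorem weakSolution_dilE {α a : ℝ} (ha : 0 < a) {F : L2Strip} {U : E4} (hU : U ∈ weakSpace α)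
    (hw : ∀ Φ ∈ weakSpace α, energyForm α U Φ = ⟪F, Φ 0⟫_ℝ) :
    dilE ha U ∈ weakSpace α ∧ ∀ Φ ∈ weakSpace α, energyForm α (dilE ha U) Φ = ⟪dilL2 ha F, Φ 0⟫_ℝ := by
  refine ⟨dilE_mem_weakSpace ha hU, fun Φ hΦ => ?_⟩
  rw [energyForm_dilE ha, hw _ (dilE_mem_weakSpace (inv_pos.2 ha) hΦ), dilE_apply, inner_dilL2 ha]

end Elgindi

end Literature.Analysis.FluidPDE
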